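import Mathlib.Combinatorics.SetFamily.FourFunctions
import Mathlib.Data.Finset.Sups
import Mathlib.Order.UpperLower.Basic
import Mathlib.Algebra.BigOperators.Ring.Finset
import Mathlib.Algebra.Order.BigOperators.Group.Finset

/-!
# `NoHeavyLowerTail` (crux stmt-CriticalPhenomena-4575), lane prim-ineq-gen-4 (gen 32): the cover-matching form of the anti-band inequality

Support file (`--supports stmt-CriticalPhenomena-4575`; memo `run/shared/lean/prim/prim-ineq-gen-4/FINDING-COVER-MATCHING-g32.md` §1, §3).
Pure finite combinatorics, no definitions, no `sorry`, standard axioms.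

CONTEXT.  (AB_l)(n): for up-sets `A, B` of `Finset (Fin n)` and the outer region `O = {s | #s < l ∨ #sᶜ < l}`,
`#{s ∈ A ∩ Bᶜˢ | s ∈ O} ≤ #{s ∈ A ∩ B | s ∈ O}` (conjectured for `n ≥ 2l`).  Gen 32 (memo §1) shows that (AB_l)(n) for a FIXED `B` and ALL up-sets
`A` is equivalent to the existence of a fractional perfect matching of `V = B ∩ O` in the "cover graph" `v ~ y ⇔ v ∪ y = univ` (loop at `univ`),
i.e. to Hall's condition `#X ≤ #{v ∈ V | ∃ x ∈ X, xᶜ ⊆ v}` for all `X ⊆ V`.  This file records the two formal halves that are theorems: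

* `antiBand_of_cover_weights` — the CERTIFICATE direction: a `k`-regular weighting `w` of the cover graph on `V = B ∩ O` (row and column sums `k > 0`,
  support on covering pairs) implies (AB_l)(n)(A, B) for every up-set `A` (three lines: `k·#LHS = Σ_{x ∈ LHS} Σ_y w xᶜ y`, every `y` in the support
  contains `x` hence lies in `A ∩ B ∩ O`, and column sums are `k`).  `k = 1` is a covering permutation, `k = 2` a perfect 2-matching; by LP duality
  some `k` exists iff (AB_l)(n)(·, B) holds (memo §1, not formalised).
* `card_le_card_cover_targets` — HALL'S CONDITION FOR FAMILIES WITH SMALL PAIRWISE DIFFERENCES: if `X ⊆ B` and `#(x \ x') < l` for all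
  `x, x' ∈ X` (e.g. all members small, `#x < l`, or all members huge, `#xᶜ < l`), then `#X ≤ #{v ∈ B ∩ O | ∃ x ∈ X, xᶜ ⊆ v}` — the targets
  `(x \ x')ᶜ = xᶜ ∪ x'` are distinct members of `B ∩ O` above `xᶜ`, and they are at least `#X` many by the Marica–Schönheim inequality
  (`Finset.card_le_card_diffs`).  So the only open part of Hall's condition is the MIXED case (memo §3–§4).
-/

namespace Summit.CriticalPhenomena.PercolationContinuityZ3.Theorems.AntiBandCoverMatching

open Finset
open scoped FinsetFamily

/-- From `s ∪ t = univ` to `sᶜ ⊆ t`. [folklore] -/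
theorem compl_subset_of_union_eq_univ {n : ℕ} {s t : Finset (Fin n)} (h : s ∪ t = univ) : sᶜ ⊆ t := by
  intro i hi
  have : i ∈ s ∪ t := h ▸ mem_univ i
  rcases mem_union.1 this with h' | h'
  · exact absurd h' (mem_compl.1 hi)
  · exact h'

/-- **Cover-matching certificate ⇒ (AB_l)(n).**  Let `B` be an up-set of `Finset (Fin n)`, `V = {v ∈ B | #v < l ∨ #vᶜ < l}` its outer part, and
`w` a weighting of ordered pairs with: row sums `∑_{y ∈ V} w v y = k` and column sums `∑_{v ∈ V} w v y = k` on `V` for some `k > 0`, and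
`w v y ≠ 0 → v ∪ y = univ` on `V × V` (a `k`-fold perfect matching of the cover graph; `k = 2` = a perfect 2-matching = a fractional perfect matching).
Then for EVERY up-set `A`: `#{s ∈ A ∩ Bᶜˢ | #s < l ∨ #sᶜ < l} ≤ #{s ∈ A ∩ B | #s < l ∨ #sᶜ < l}`. [this work; memo FINDING-COVER-MATCHING-g32 §1] -/
theorem antiBand_of_cover_weights {n : ℕ} (l : ℕ) (A B : Finset (Finset (Fin n)))
    (hA : IsUpperSet (A : Set (Finset (Fin n))))
    (w : Finset (Fin n) → Finset (Fin n) → ℕ) (k : ℕ) (hk : 0 < k)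
    (hrow : ∀ v ∈ B.filter (fun s => #s < l ∨ #sᶜ < l), ∑ y ∈ B.filter (fun s => #s < l ∨ #sᶜ < l), w v y = k)
    (hcol : ∀ y ∈ B.filter (fun s => #s < l ∨ #sᶜ < l), ∑ v ∈ B.filter (fun s => #s < l ∨ #sᶜ < l), w v y = k)
    (hcov : ∀ v ∈ B.filter (fun s => #s < l ∨ #sᶜ < l), ∀ y ∈ B.filter (fun s => #s < l ∨ #sᶜ < l), w v y ≠ 0 → v ∪ y = univ) :
    #((A ∩ Bᶜˢ).filter fun s => #s < l ∨ #sᶜ < l) ≤ #((A ∩ B).filter fun s => #s < l ∨ #sᶜ < l) := by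
  classical
  set V := B.filter (fun s => #s < l ∨ #sᶜ < l) with hVdef
  set L := (A ∩ Bᶜˢ).filter (fun s => #s < l ∨ #sᶜ < l) with hLdef
  set R := (A ∩ B).filter (fun s => #s < l ∨ #sᶜ < l) with hRdef
  have hRV : R ⊆ V := by
    intro y hy
    rw [hRdef, mem_filter, mem_inter] at hy
    exact mem_filter.2 ⟨hy.1.2, hy.2⟩
  -- complements of members of `L` lie in `V`
  have hLc : ∀ x ∈ L, xᶜ ∈ V := by
    intro x hx
    rw [hLdef, mem_filter, mem_inter, mem_compls] at hx
    refine mem_filter.2 ⟨hx.1.2, ?_⟩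
    rw [compl_compl]
    exact hx.2.symm
  -- for `x ∈ L`, every `y` in the support of `w xᶜ ·` lies in `R`
  have hsupp : ∀ x ∈ L, ∀ y ∈ V, w xᶜ y ≠ 0 → y ∈ R := by
    intro x hx y hy hne
    have hxy : x ⊆ y := by
      have := compl_subset_of_union_eq_univ (hcov xᶜ (hLc x hx) y hy hne)
      rwa [compl_compl] at this
    have hxA : x ∈ A := (mem_inter.1 (mem_filter.1 hx).1).1
    have hy' := mem_filter.1 hy
    exact mem_filter.2 ⟨mem_inter.2 ⟨hA hxy hxA, hy'.1⟩, hy'.2⟩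
  -- row sums restricted to `R`
  have hrowR : ∀ x ∈ L, ∑ y ∈ R, w xᶜ y = k := by
    intro x hx
    rw [← hrow xᶜ (hLc x hx)]
    exact Finset.sum_subset hRV fun y hyV hyR => by
      by_contra hne
      exact hyR (hsupp x hx y hyV hne)
  -- column sums over `L.image compl` are at most `k`
  have hcolL : ∀ y ∈ R, ∑ x ∈ L, w xᶜ y ≤ k := by
    intro y hy
    have himg : L.image compl ⊆ V := by
      intro v hv
      obtain ⟨x, hx, rfl⟩ := mem_image.1 hv
      exact hLc x hx
    calc ∑ x ∈ L, w xᶜ y = ∑ v ∈ L.image compl, w v y := by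
          rw [sum_image]
          intro x _ x' _ h
          exact compl_injective h
      _ ≤ ∑ v ∈ V, w v y := sum_le_sum_of_subset_of_nonneg himg fun _ _ _ => Nat.zero_le _
      _ = k := hcol y (hRV hy)
  -- double count
  have key : k * #L ≤ k * #R := by
    calc k * #L = ∑ x ∈ L, k := by simp [mul_comm]
      _ = ∑ x ∈ L, ∑ y ∈ R, w xᶜ y := sum_congr rfl fun x hx => (hrowR x hx).symm
      _ = ∑ y ∈ R, ∑ x ∈ L, w xᶜ y := sum_comm
      _ ≤ ∑ y ∈ R, k := sum_le_sum hcolL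
      _ = k * #R := by simp [mul_comm]
  exact Nat.le_of_mul_le_mul_left key hk

/-- **Hall's condition for the cover graph when pairwise differences are small (Marica–Schönheim).**  Let `B` be an up-set of `Finset (Fin n)` and
`X ⊆ B` a family with `#(x \ x') < l` for all `x, x' ∈ X` — e.g. all members small (`#x < l`) or all members huge (`#xᶜ < l`).  Then the members of
`B ∩ O` lying above the complement of some member of `X` are at least `#X` many: the sets `(x \ x')ᶜ = xᶜ ∪ x'` (`x, x' ∈ X`) qualify and are
`#(X \\ X) ≥ #X` many (`Finset.card_le_card_diffs`). [this work; memo FINDING-COVER-MATCHING-g32 §3; Marica–Schönheim 1969] -/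
theorem card_le_card_cover_targets {n : ℕ} (l : ℕ) (B X : Finset (Finset (Fin n)))
    (hB : IsUpperSet (B : Set (Finset (Fin n)))) (hXB : X ⊆ B)
    (hX : ∀ x ∈ X, ∀ x' ∈ X, #(x \ x') < l) :
    #X ≤ #((B.filter fun s => #s < l ∨ #sᶜ < l).filter fun v => ∃ x ∈ X, xᶜ ⊆ v) := by
  classical
  calc #X ≤ #(X \\ X) := X.card_le_card_diffs
    _ = #((X \\ X).image compl) := by
        rw [card_image_of_injOn]
        intro d _ d' _ h
        exact compl_injective h
    _ ≤ #((B.filter fun s => #s < l ∨ #sᶜ < l).filter fun v => ∃ x ∈ X, xᶜ ⊆ v) := by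
        apply card_le_card
        intro v hv
        obtain ⟨d, hd, rfl⟩ := mem_image.1 hv
        obtain ⟨x, hx, x', hx', rfl⟩ := mem_diffs.1 hd
        rw [mem_filter, mem_filter]
        refine ⟨⟨?_, Or.inr ?_⟩, x, hx, ?_⟩
        · -- `(x \ x')ᶜ ⊇ x' ∈ B`
          refine hB (show x' ≤ (x \ x')ᶜ from ?_) (hXB hx')
          intro i hi
          rw [mem_compl, mem_sdiff]
          exact fun h => h.2 hi
        · rw [compl_compl]; exact hX x hx x' hx'
        · exact compl_le_compl sdiff_subset

/-- Hall's condition for families of SMALL members (`#x < l`). [this work] -/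
theorem card_le_card_cover_targets_of_small {n : ℕ} (l : ℕ) (B X : Finset (Finset (Fin n)))
    (hB : IsUpperSet (B : Set (Finset (Fin n)))) (hXB : X ⊆ B) (hX : ∀ x ∈ X, #x < l) :
    #X ≤ #((B.filter fun s => #s < l ∨ #sᶜ < l).filter fun v => ∃ x ∈ X, xᶜ ⊆ v) :=
  card_le_card_cover_targets l B X hB hXB fun x hx _ _ => lt_of_le_of_lt (card_le_card sdiff_subset) (hX x hx)

/-- Hall's condition for families of HUGE members (`#xᶜ < l`). [this work] -/
theorem card_le_card_cover_targets_of_huge {n : ℕ} (l : ℕ) (B X : Finset (Finset (Fin n)))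
    (hB : IsUpperSet (B : Set (Finset (Fin n)))) (hXB : X ⊆ B) (hX : ∀ x ∈ X, #xᶜ < l) :
    #X ≤ #((B.filter fun s => #s < l ∨ #sᶜ < l).filter fun v => ∃ x ∈ X, xᶜ ⊆ v) := by
  refine card_le_card_cover_targets l B X hB hXB fun x _ x' hx' => lt_of_le_of_lt (card_le_card ?_) (hX x' hx')
  intro i hi
  rw [mem_sdiff] at hi
  exact mem_compl.2 hi.2

/-! ### Gen 33 appendix: differences outside the band, and Hall for ONE small / ONE huge member -/

/-- **Hall's condition when no difference lies in the band.**  If `X ⊆ B` (`B` an up-set) and every difference `x \ x'` (`x, x' ∈ X`) is small or huge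
(`#(x \ x') < l ∨ #(x \ x')ᶜ < l`), then `#X ≤ #{v ∈ B ∩ O | ∃ x ∈ X, xᶜ ⊆ v}`: the complements `(x \ x')ᶜ = xᶜ ∪ x' ⊇ x'` lie in `B ∩ O` above `xᶜ`,
and `#(X \\ X) ≥ #X` (Marica–Schönheim).  Generalises `card_le_card_cover_targets` (all differences small); the whole difficulty of (AB) is thus in the
differences of band size. [this work; memo FINDING-THRESHOLD-JUNTA-g33 §2.7] -/
theorem card_le_card_cover_targets_of_outer_diffs {n : ℕ} (l : ℕ) (B X : Finset (Finset (Fin n)))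
    (hB : IsUpperSet (B : Set (Finset (Fin n)))) (hXB : X ⊆ B)
    (hX : ∀ x ∈ X, ∀ x' ∈ X, #(x \ x') < l ∨ #(x \ x')ᶜ < l) :
    #X ≤ #((B.filter fun s => #s < l ∨ #sᶜ < l).filter fun v => ∃ x ∈ X, xᶜ ⊆ v) := by
  classical
  calc #X ≤ #(X \\ X) := X.card_le_card_diffs
    _ = #((X \\ X).image compl) := by
        rw [card_image_of_injOn]
        intro d _ d' _ h
        exact compl_injective h
    _ ≤ #((B.filter fun s => #s < l ∨ #sᶜ < l).filter fun v => ∃ x ∈ X, xᶜ ⊆ v) := by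
        apply card_le_card
        intro v hv
        obtain ⟨d, hd, rfl⟩ := mem_image.1 hv
        obtain ⟨x, hx, x', hx', rfl⟩ := mem_diffs.1 hd
        rw [mem_filter, mem_filter]
        refine ⟨⟨?_, ?_⟩, x, hx, compl_le_compl sdiff_subset⟩
        · refine hB (show x' ≤ (x \ x')ᶜ from ?_) (hXB hx')
          intro i hi
          rw [mem_compl, mem_sdiff]
          exact fun h => h.2 hi
        · rw [compl_compl]; exact (hX x hx x' hx').symm

/-- **Hall's condition for ONE small member** (settles the "one huge member" residue of gen 32's memo §7.3, in its mirror form).  Let `B` be an up-set,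
`x₀ ∈ B` small (`#x₀ < l`, `1 ≤ l`, `2l ≤ n`), and `Y ⊆ B` a family of huge members (`#yᶜ < l`) no two of which (a member and itself included) cover `univ`.
Then `#(insert x₀ Y) ≤ #{v ∈ B ∩ O | ∃ x ∈ insert x₀ Y, xᶜ ⊆ v}`.  Proof: if every `y \ x₀` (`y ∈ Y`) is small, all differences are small
(`card_le_card_cover_targets`); otherwise pick `u ⊆ y₁ \ x₀` with `#u = l − 1`: `uᶜ ⊇ x₀` lies in `B ∩ O`, is above `y₁ᶜ`, and is not one of the
Marica–Schönheim targets `(y \ y')ᶜ` of `Y` (that would force `y ∪ y' = univ`), so it is one target more than `#Y`. [this work; memo §2.7] -/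
theorem card_le_card_cover_targets_one_small {n : ℕ} (l : ℕ) (hl : 1 ≤ l) (h2l : 2 * l ≤ n) (B : Finset (Finset (Fin n)))
    (hB : IsUpperSet (B : Set (Finset (Fin n)))) (x₀ : Finset (Fin n)) (hx₀B : x₀ ∈ B) (hx₀ : #x₀ < l)
    (Y : Finset (Finset (Fin n))) (hYB : Y ⊆ B) (hYhuge : ∀ y ∈ Y, #yᶜ < l) (hYco : ∀ y ∈ Y, ∀ y' ∈ Y, y ∪ y' ≠ univ) :
    #(insert x₀ Y) ≤ #((B.filter fun s => #s < l ∨ #sᶜ < l).filter fun v => ∃ x ∈ insert x₀ Y, xᶜ ⊆ v) := by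
  classical
  have hXB : insert x₀ Y ⊆ B := insert_subset hx₀B hYB
  by_cases hA : ∃ y₁ ∈ Y, l - 1 ≤ #(y₁ \ x₀)
  · obtain ⟨y₁, hy₁, hbig⟩ := hA
    obtain ⟨u, huy, hu⟩ := exists_subset_card_eq hbig
    set T := (B.filter fun s => #s < l ∨ #sᶜ < l).filter fun v => ∃ x ∈ insert x₀ Y, xᶜ ⊆ v with hTdef
    -- the Marica–Schönheim targets of `Y`
    have hMS : (Y \\ Y).image compl ⊆ T := by
      intro v hv
      obtain ⟨d, hd, rfl⟩ := mem_image.1 hv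
      obtain ⟨y, hy, y', hy', rfl⟩ := mem_diffs.1 hd
      rw [hTdef, mem_filter, mem_filter]
      refine ⟨⟨?_, Or.inr ?_⟩, y, mem_insert_of_mem hy, compl_le_compl sdiff_subset⟩
      · refine hB (show y' ≤ (y \ y')ᶜ from ?_) (hYB hy')
        intro i hi
        rw [mem_compl, mem_sdiff]
        exact fun h => h.2 hi
      · rw [compl_compl]
        refine lt_of_le_of_lt (card_le_card ?_) (hYhuge y' hy')
        intro i hi
        rw [mem_sdiff] at hi
        exact mem_compl.2 hi.2
    -- the extra target `uᶜ`
    have hwT : uᶜ ∈ T := by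
      rw [hTdef, mem_filter, mem_filter]
      refine ⟨⟨?_, Or.inr ?_⟩, y₁, mem_insert_of_mem hy₁, ?_⟩
      · refine hB (show x₀ ≤ uᶜ from ?_) hx₀B
        intro i hi
        rw [mem_compl]
        exact fun hiu => (mem_sdiff.1 (huy hiu)).2 hi
      · rw [compl_compl, hu]; omega
      · exact compl_le_compl fun i hiu => (mem_sdiff.1 (huy hiu)).1
    have hwnot : uᶜ ∉ (Y \\ Y).image compl := by
      intro hw
      obtain ⟨d, hd, hdu⟩ := mem_image.1 hw
      have hdu' : d = u := compl_injective hdu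
      obtain ⟨y, hy, y', hy', rfl⟩ := mem_diffs.1 hd
      -- `u = y \ y' ⊆ y'ᶜ` and `#y'ᶜ ≤ l - 1 = #u` force `y'ᶜ = y \ y' ⊆ y`, so `y ∪ y' = univ`
      have hsub : y \ y' ⊆ y'ᶜ := by
        intro i hi
        rw [mem_sdiff] at hi
        exact mem_compl.2 hi.2
      have hcard : #y'ᶜ ≤ #(y \ y') := by
        rw [hdu', hu]
        have := hYhuge y' hy'
        omega
      have heq : y \ y' = y'ᶜ := eq_of_subset_of_card_le hsub hcard
      apply hYco y hy y' hy'
      ext i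
      simp only [mem_union, mem_univ, iff_true]
      by_cases hi : i ∈ y'
      · exact Or.inr hi
      · have : i ∈ y'ᶜ := mem_compl.2 hi
        rw [← heq, mem_sdiff] at this
        exact Or.inl this.1
    have hx₀Y : x₀ ∉ Y := by
      intro h
      have h1 := hYhuge x₀ h
      have h2 : #x₀ᶜ = n - #x₀ := by rw [card_compl, Fintype.card_fin]
      omega
    calc #(insert x₀ Y) = #Y + 1 := card_insert_of_notMem hx₀Y
      _ ≤ #(Y \\ Y) + 1 := Nat.add_le_add_right Y.card_le_card_diffs 1
      _ = #((Y \\ Y).image compl) + 1 := by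
          rw [card_image_of_injOn]
          intro d _ d' _ h
          exact compl_injective h
      _ = #(insert uᶜ ((Y \\ Y).image compl)) := (card_insert_of_notMem hwnot).symm
      _ ≤ #T := card_le_card (insert_subset hwT hMS)
  · -- all differences are small
    rw [not_exists] at hA
    refine card_le_card_cover_targets l B (insert x₀ Y) hB hXB ?_
    intro x hx x' hx'
    rw [mem_insert] at hx hx'
    rcases hx with rfl | hx
    · exact lt_of_le_of_lt (card_le_card sdiff_subset) hx₀
    · rcases hx' with rfl | hx'
      · have := hA x
        rw [not_and] at this
        have h := this hx
        omega
      · refine lt_of_le_of_lt (card_le_card ?_) (hYhuge x' hx')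
        intro i hi
        rw [mem_sdiff] at hi
        exact mem_compl.2 hi.2

/-- **Hall's condition for ONE huge member** (gen 32 memo §7.3, now in every cell).  Let `B` be an up-set, `x₁ ∈ B` huge (`#x₁ᶜ < l`, `1 ≤ l`, `2l ≤ n`), and
`Y ⊆ B` a family of small members (`#y < l`) that pairwise intersect (a member with itself included, i.e. `∅ ∉ Y`).  Then
`#(insert x₁ Y) ≤ #{v ∈ B ∩ O | ∃ x ∈ insert x₁ Y, xᶜ ⊆ v}`.  Mirror of `card_le_card_cover_targets_one_small`: the extra target is `uᶜ` for
`u ⊆ x₁ \ y₁` with `#u = l − 1` (above `x₁ᶜ`, in `B` as a superset of `y₁`). [this work; memo §2.7] -/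
theorem card_le_card_cover_targets_one_huge {n : ℕ} (l : ℕ) (hl : 1 ≤ l) (h2l : 2 * l ≤ n) (B : Finset (Finset (Fin n)))
    (hB : IsUpperSet (B : Set (Finset (Fin n)))) (x₁ : Finset (Fin n)) (hx₁B : x₁ ∈ B) (hx₁ : #x₁ᶜ < l)
    (Y : Finset (Finset (Fin n))) (hYB : Y ⊆ B) (hYsmall : ∀ y ∈ Y, #y < l) (hYint : ∀ y ∈ Y, ∀ y' ∈ Y, (y ∩ y').Nonempty) :
    #(insert x₁ Y) ≤ #((B.filter fun s => #s < l ∨ #sᶜ < l).filter fun v => ∃ x ∈ insert x₁ Y, xᶜ ⊆ v) := by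
  classical
  have hXB : insert x₁ Y ⊆ B := insert_subset hx₁B hYB
  by_cases hA : ∃ y₁ ∈ Y, l - 1 ≤ #(x₁ \ y₁)
  · obtain ⟨y₁, hy₁, hbig⟩ := hA
    obtain ⟨u, hux, hu⟩ := exists_subset_card_eq hbig
    set T := (B.filter fun s => #s < l ∨ #sᶜ < l).filter fun v => ∃ x ∈ insert x₁ Y, xᶜ ⊆ v with hTdef
    have hMS : (Y \\ Y).image compl ⊆ T := by
      intro v hv
      obtain ⟨d, hd, rfl⟩ := mem_image.1 hv
      obtain ⟨y, hy, y', hy', rfl⟩ := mem_diffs.1 hd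
      rw [hTdef, mem_filter, mem_filter]
      refine ⟨⟨?_, Or.inr ?_⟩, y, mem_insert_of_mem hy, compl_le_compl sdiff_subset⟩
      · refine hB (show y' ≤ (y \ y')ᶜ from ?_) (hYB hy')
        intro i hi
        rw [mem_compl, mem_sdiff]
        exact fun h => h.2 hi
      · rw [compl_compl]
        exact lt_of_le_of_lt (card_le_card sdiff_subset) (hYsmall y hy)
    have hwT : uᶜ ∈ T := by
      rw [hTdef, mem_filter, mem_filter]
      refine ⟨⟨?_, Or.inr ?_⟩, x₁, mem_insert_self _ _, ?_⟩
      · refine hB (show y₁ ≤ uᶜ from ?_) (hYB hy₁)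
        intro i hi
        rw [mem_compl]
        exact fun hiu => (mem_sdiff.1 (hux hiu)).2 hi
      · rw [compl_compl, hu]; omega
      · intro i hi
        rw [mem_compl] at hi ⊢
        exact fun hiu => hi (mem_sdiff.1 (hux hiu)).1
    have hwnot : uᶜ ∉ (Y \\ Y).image compl := by
      intro hw
      obtain ⟨d, hd, hdu⟩ := mem_image.1 hw
      have hdu' : d = u := compl_injective hdu
      obtain ⟨y, hy, y', hy', rfl⟩ := mem_diffs.1 hd
      -- `#(y \ y') ≤ #y - 1 < l - 1 = #u` since `y ∩ y' ≠ ∅`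
      obtain ⟨i, hi⟩ := hYint y hy y' hy'
      have h1 : #(y \ y') < #y := by
        apply card_lt_card
        refine ⟨sdiff_subset, fun h => ?_⟩
        have := h (mem_inter.1 hi).1
        rw [mem_sdiff] at this
        exact this.2 (mem_inter.1 hi).2
      have h2 := hYsmall y hy
      rw [hdu', hu] at h1
      omega
    have hx₁Y : x₁ ∉ Y := by
      intro h
      have h1 := hYsmall x₁ h
      have h2 : #x₁ᶜ = n - #x₁ := by rw [card_compl, Fintype.card_fin]
      omega
    calc #(insert x₁ Y) = #Y + 1 := card_insert_of_notMem hx₁Y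
      _ ≤ #(Y \\ Y) + 1 := Nat.add_le_add_right Y.card_le_card_diffs 1
      _ = #((Y \\ Y).image compl) + 1 := by
          rw [card_image_of_injOn]
          intro d _ d' _ h
          exact compl_injective h
      _ = #(insert uᶜ ((Y \\ Y).image compl)) := (card_insert_of_notMem hwnot).symm
      _ ≤ #T := card_le_card (insert_subset hwT hMS)
  · rw [not_exists] at hA
    refine card_le_card_cover_targets l B (insert x₁ Y) hB hXB ?_
    intro x hx x' hx'
    rw [mem_insert] at hx hx'
    rcases hx with rfl | hx
    · rcases hx' with rfl | hx'
      · rw [sdiff_self, bot_eq_empty, card_empty]; omega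
      · have := hA x'
        rw [not_and] at this
        have h := this hx'
        omega
    · exact lt_of_le_of_lt (card_le_card sdiff_subset) (hYsmall x hx)

end Summit.CriticalPhenomena.PercolationContinuityZ3.Theorems.AntiBandCoverMatching
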